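import Mathlib
import Literature.LinearAlgebra.Matrix.PermanentSubperm
import Summits.ValiantsHypothesis.ValiantsHypothesis.Theorems.ValuativeGCTValuativeFlipCyclicArcs

/-!
# Cofactors of the cyclic tridiagonal matrix (crux `ValuativeGCT.ValuativeFlip`, stub `stub_fourRowPencilRank`)

P1 (second half) of the cyclic-tridiagonal architecture for hypothesis `H` of
`fourRowPencilRank_of_pencilCertificate` (`Cruxes/ValuativeFlip/AxisK9G1a2CyclicTridiagonal.md` §2),
over any commutative ring `R`, `n ≥ 3`, for the cyclic tridiagonal matrix `cycM l m m'`
(file `…CyclicArcs`):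

* `subperm_arc_del_first` / `subperm_arc_del_last` — path minors with the FIRST (resp. LAST)
  column of the arc and the row `a+t` deleted: `m_a⋯m_{a+t-1} · K(a+t+1, L-1-t)` (resp.
  `K(a,t) · m'_{a+t+1}⋯m'_{a+s+t}`) — the free column forces a monotone path (expand along the
  first, resp. last, row: a single term; induct);
* `subperm_ne_ne_eq_Tw_add_Sw` — **the cofactor formula**: deleting row `q+e` and column `q`
  (`n = e+k+1`, `1 ≤ e`) gives `Tw l m m' q e + Sw l m m' (q+e) (k+1)` (expand along row `q`: the
  two entries `m_q`, `m'_q` lead to the two path minors of the arc `q+1, …, q-1`);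
  `subperm_ne_ne_eq_kont` — deleting row and column `q` gives `K(q+1, n-1)`.
With `VonZurGathen.pderiv_perPoly` (`∂_{rc} per = X.subperm (· ≠ c) (· ≠ r)`) these are the
cofactors `(∂_{ij} per_n)(M·X)` of hypothesis `H`. [this crux; classical combinatorics]
-/

set_option linter.dupNamespace false

namespace Summit.ValiantsHypothesis.ValiantsHypothesis.Theorems.ValuativeFlip

open scoped BigOperators

section cofactor

variable {R : Type*} [CommRing R] {n : ℕ} (l m m' : ZMod n → R) [NeZero n]

/-- **Path minor, first column deleted**: on the arc `a, …, a+L-1` (`L ≤ n-1`), deleting the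
column `a` and the row `a + t` (`t < L`) leaves `m_a ⋯ m_{a+t-1} · K(a+t+1, L-1-t)`: the free
first column forces the clockwise path `a → a+1 → ⋯ → a+t`. [this crux] -/
theorem subperm_arc_del_first (hn : 3 ≤ n) :
    ∀ (t : ℕ) (a : ZMod n) (L : ℕ), t < L → L + 1 ≤ n →
      (cycM l m m').subperm (fun c => inArc a L c ∧ c ≠ a)
        (fun r => inArc a L r ∧ r ≠ a + (t : ZMod n)) =
        cstr m a t * kont l m m' (a + ((t + 1 : ℕ) : ZMod n)) (L - 1 - t) := by
  intro t
  induction t with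
  | zero =>
    intro a L ht hL
    obtain ⟨L', rfl⟩ : ∃ L', L = L' + 1 := ⟨L - 1, by omega⟩
    rw [(cycM l m m').subperm_congr (inArc_succ_and_ne_first (by omega))
      (fun v => by simpa using inArc_succ_and_ne_first (a := a) (L := L') (by omega) v),
      subperm_arc_eq_kont l m m' hn L' (by omega)]
    simp
  | succ t ih =>
    intro a L ht hL
    obtain ⟨L', rfl⟩ : ∃ L', L = L' + 1 := ⟨L - 1, by omega⟩
    have h1 := one_ne_zero_zmod (n := n) (by omega)
    have hrow : inArc a (L' + 1) a ∧ a ≠ a + ((t + 1 : ℕ) : ZMod n) := by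
      refine ⟨inArc_self (by omega) (by omega), fun h => ?_⟩
      exact natCast_zmod_ne_zero (n := n) (s := t + 1) (by omega) (by omega)
        (by linear_combination -h)
    have hp1 : inArc a (L' + 1) (a + 1) ∧ a + 1 ≠ a :=
      ⟨by simpa using inArc_add (a := a) (L := L' + 1) (s := 1) (by omega) (by omega),
        fun h => h1 (by linear_combination h)⟩
    rw [subperm_cycM_expand l m m' hn a hrow,
      if_neg (fun h => not_inArc_sub_one (by omega) h.1), if_neg (fun h => h.2 rfl), if_pos hp1,
      zero_add, zero_add]
    have hsub : (cycM l m m').subperm (fun c => (inArc a (L' + 1) c ∧ c ≠ a) ∧ c ≠ a + 1)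
        (fun j => (inArc a (L' + 1) j ∧ j ≠ a + ((t + 1 : ℕ) : ZMod n)) ∧ j ≠ a) =
        cstr m (a + 1) t * kont l m m' (a + 1 + ((t + 1 : ℕ) : ZMod n)) (L' - 1 - t) := by
      rw [← ih (a + 1) L' (by omega) (by omega)]
      refine (cycM l m m').subperm_congr (fun v => ?_) (fun v => ?_)
      · rw [inArc_succ_and_ne_first (by omega)]
      · rw [← inArc_succ_and_ne_first (L := L') (by omega)]
        have heq : a + 1 + (t : ZMod n) = a + ((t + 1 : ℕ) : ZMod n) := by push_cast; ring
        rw [heq]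
        constructor
        · rintro ⟨⟨h1, h2⟩, h3⟩; exact ⟨⟨h1, h3⟩, h2⟩
        · rintro ⟨⟨h1, h2⟩, h3⟩; exact ⟨⟨h1, h3⟩, h2⟩
    rw [hsub, cstr_succ_left,
      show a + 1 + ((t + 1 : ℕ) : ZMod n) = a + ((t + 1 + 1 : ℕ) : ZMod n) by push_cast; ring,
      show L' + 1 - 1 - (t + 1) = L' - 1 - t by omega]
    ring

/-- **Path minor, last column deleted**: on the arc `a, …, a+s+t` (`s+t+2 ≤ n`), deleting the
last column `a+s+t` and the row `a + t` leaves `K(a, t) · m'_{a+t+1} ⋯ m'_{a+s+t}`: the free last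
column forces the counter-clockwise path `a+s+t → ⋯ → a+t`. [this crux] -/
theorem subperm_arc_del_last (hn : 3 ≤ n) :
    ∀ (s t : ℕ) (a : ZMod n), s + t + 2 ≤ n →
      (cycM l m m').subperm (fun c => inArc a (s + t + 1) c ∧ c ≠ a + ((s + t : ℕ) : ZMod n))
        (fun r => inArc a (s + t + 1) r ∧ r ≠ a + (t : ZMod n)) =
        kont l m m' a t * cstr m' (a + ((t + 1 : ℕ) : ZMod n)) s := by
  intro s
  induction s with
  | zero =>
    intro t a h
    rw [(cycM l m m').subperm_congr
      (fun v => by simpa using inArc_succ_and_ne_last (a := a) (L := t) (by omega) v)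
      (fun v => by simpa using inArc_succ_and_ne_last (a := a) (L := t) (by omega) v),
      subperm_arc_eq_kont l m m' hn t (by omega)]
    simp
  | succ s ih =>
    intro t a h
    -- expand along the last row `r₀ = a + (s+1+t)`; its own column is the deleted one
    have hL : s + 1 + t + 1 = (s + t + 1) + 1 := by ring
    set r₀ : ZMod n := a + ((s + 1 + t : ℕ) : ZMod n) with hr₀
    have hr₀' : r₀ = a + ((s + t + 1 : ℕ) : ZMod n) := by rw [hr₀]; push_cast; ring
    have hprev : r₀ - 1 = a + ((s + t : ℕ) : ZMod n) := by rw [hr₀]; push_cast; ring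
    have hrow : inArc a (s + 1 + t + 1) r₀ ∧ r₀ ≠ a + (t : ZMod n) := by
      refine ⟨inArc_add (by omega) (by omega), fun h' => ?_⟩
      have := natCast_zmod_inj (n := n) (by omega) (by omega) (add_left_cancel h')
      omega
    have hout : ¬ (inArc a (s + 1 + t + 1) (r₀ + 1) ∧ r₀ + 1 ≠ r₀) := by
      rintro ⟨h', -⟩
      rw [show r₀ + 1 = a + ((s + 1 + t + 1 : ℕ) : ZMod n) by rw [hr₀]; push_cast; ring] at h'
      exact not_inArc_add_self (by omega) h'
    have hp1 : inArc a (s + 1 + t + 1) (r₀ - 1) ∧ r₀ - 1 ≠ r₀ :=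
      ⟨by rw [hprev]; exact inArc_add (by omega) (by omega),
        fun h' => one_ne_zero_zmod (n := n) (by omega) (by linear_combination -h')⟩
    rw [subperm_cycM_expand l m m' hn r₀ hrow,
      if_neg (show ¬ (inArc a (s + 1 + t + 1) r₀ ∧ r₀ ≠ r₀) from fun h' => h'.2 rfl), if_neg hout,
      if_pos hp1, add_zero, add_zero]
    have hsub : (cycM l m m').subperm
        (fun c => (inArc a (s + 1 + t + 1) c ∧ c ≠ r₀) ∧ c ≠ r₀ - 1)
        (fun j => (inArc a (s + 1 + t + 1) j ∧ j ≠ a + (t : ZMod n)) ∧ j ≠ r₀) =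
        kont l m m' a t * cstr m' (a + ((t + 1 : ℕ) : ZMod n)) s := by
      rw [← ih t a (by omega)]
      refine (cycM l m m').subperm_congr (fun v => ?_) (fun v => ?_)
      · rw [hprev, hL, hr₀', inArc_succ_and_ne_last (L := s + t + 1) (by omega)]
      · rw [hL, hr₀', ← inArc_succ_and_ne_last (a := a) (L := s + t + 1) (by omega)]
        constructor
        · rintro ⟨⟨h1, h2⟩, h3⟩; exact ⟨⟨h1, h3⟩, h2⟩
        · rintro ⟨⟨h1, h2⟩, h3⟩; exact ⟨⟨h1, h3⟩, h2⟩
    rw [hsub, cstr_succ, hr₀,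
      show a + ((t + 1 : ℕ) : ZMod n) + (s : ZMod n) = a + ((s + 1 + t : ℕ) : ZMod n) by
        push_cast; ring]
    ring

/-- **Cofactor of the cyclic tridiagonal matrix, off-diagonal**: deleting the row `q + e` and the
column `q` (`n = e + k + 1`, `1 ≤ e`) gives `T + S = Tw q e + Sw (q+e) (k+1)`. [this crux] -/
theorem subperm_ne_ne_eq_Tw_add_Sw (hn3 : 3 ≤ n) (q : ZMod n) {e k : ℕ} (hn : n = e + k + 1)
    (he : 1 ≤ e) :
    (cycM l m m').subperm (fun c => c ≠ q) (fun r => r ≠ q + (e : ZMod n)) =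
      Tw l m m' q e + Sw l m m' (q + (e : ZMod n)) (k + 1) := by
  obtain ⟨e, rfl⟩ : ∃ e', e = e' + 1 := ⟨e - 1, by omega⟩
  have hq : q + ((e + 1 : ℕ) : ZMod n) = q + 1 + (e : ZMod n) := by push_cast; ring
  rw [hq]
  have hrow : q ≠ q + 1 + (e : ZMod n) := fun h =>
    natCast_zmod_ne_zero (n := n) (s := e + 1) (by omega) (by omega)
      (by push_cast; linear_combination -h)
  have h1 := one_ne_zero_zmod (n := n) (by omega)
  rw [subperm_cycM_expand l m m' hn3 q hrow, if_neg (show ¬ (q ≠ q) from fun h => h rfl),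
    if_pos (show q - 1 ≠ q from fun h => h1 (by linear_combination -h)),
    if_pos (show q + 1 ≠ q from fun h => h1 (by linear_combination h)), add_zero]
  -- clockwise term: path minor of the arc `q+1, …, q-1` with its first column deleted
  have hT : (cycM l m m').subperm (fun c => c ≠ q ∧ c ≠ q + 1)
      (fun j => j ≠ q + 1 + (e : ZMod n) ∧ j ≠ q) =
      cstr m (q + 1) e * kont l m m' (q + 1 + ((e + 1 : ℕ) : ZMod n)) (n - 1 - 1 - e) := by
    rw [← subperm_arc_del_first l m m' hn3 e (q + 1) (n - 1) (by omega) (by omega)]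
    refine (cycM l m m').subperm_congr (fun v => ?_) (fun v => ?_)
    · rw [ne_iff_inArc q v]
    · rw [ne_iff_inArc q v]; exact and_comm
  -- counter-clockwise term: path minor with the last column deleted
  have hlast : q - 1 = q + 1 + ((k + e : ℕ) : ZMod n) := by
    have h0 : ((e + 1 + k + 1 : ℕ) : ZMod n) = 0 := by rw [← hn, ZMod.natCast_self]
    push_cast at h0 ⊢
    linear_combination -h0
  have hS : (cycM l m m').subperm (fun c => c ≠ q ∧ c ≠ q - 1)
      (fun j => j ≠ q + 1 + (e : ZMod n) ∧ j ≠ q) =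
      kont l m m' (q + 1) e * cstr m' (q + 1 + ((e + 1 : ℕ) : ZMod n)) k := by
    rw [← subperm_arc_del_last l m m' hn3 k e (q + 1) (by omega), hlast,
      show k + e + 1 = n - 1 by omega]
    refine (cycM l m m').subperm_congr (fun v => ?_) (fun v => ?_)
    · rw [ne_iff_inArc q v]
    · rw [ne_iff_inArc q v]; exact and_comm
  rw [hT, hS]
  unfold Tw Sw
  have z0 : ((e + 1 + k + 1 : ℕ) : ZMod n) = 0 := by rw [← hn, ZMod.natCast_self]
  have i1 : n - 1 - (e + 1) = n - 1 - 1 - e := by omega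
  have i2 : n - 1 - (k + 1) = e := by omega
  have i3 : q + ((e + 1 + 1 : ℕ) : ZMod n) = q + 1 + ((e + 1 : ℕ) : ZMod n) := by push_cast; ring
  have i4 : q + 1 + (e : ZMod n) + ((k + 1 + 1 : ℕ) : ZMod n) = q + 1 := by
    push_cast at z0 ⊢; linear_combination z0
  have i5 : q + 1 + (e : ZMod n) + 1 = q + 1 + ((e + 1 : ℕ) : ZMod n) := by push_cast; ring
  rw [i1, i2, i3, i4, i5, cstr_succ_left m q e, cstr_succ m' (q + 1 + ((e + 1 : ℕ) : ZMod n)) k]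
  have i6 : q + 1 + ((e + 1 : ℕ) : ZMod n) + (k : ZMod n) = q := by
    push_cast at z0 ⊢; linear_combination z0
  rw [i6]
  ring

/-- **Cofactor of the cyclic tridiagonal matrix, diagonal**: deleting row and column `q` gives
`K(q+1, n-1)`. [this crux] -/
theorem subperm_ne_ne_eq_kont (hn3 : 3 ≤ n) (q : ZMod n) :
    (cycM l m m').subperm (fun c => c ≠ q) (fun r => r ≠ q) = kont l m m' (q + 1) (n - 1) := by
  rw [(cycM l m m').subperm_congr (ne_iff_inArc q) (ne_iff_inArc q),
    subperm_arc_eq_kont l m m' hn3 (n - 1) (by omega)]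

end cofactor

end Summit.ValiantsHypothesis.ValiantsHypothesis.Theorems.ValuativeFlip
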